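import Summits.Schanuel.Schanuel.Theorems.RootDecomp1KXTop03

/-!
# RootDecomp1KXAll — lens 1, generation 46, node 5 «ALL CURVES: ThinFibreAt m₀ P for EVERY P ∈ ℤ[x][Y], P ≠ 0, at every m₀ ≥ thinThreshold P = max(3, 2·μ(P)+1, e(P)+1)» (CLAIM L2336, PRICE + CHECKLIST K-g46 L2337, NODE L2353, critic VERDICT L2357: CLEARED THEOREM ×1 under K-R35 — the last threshold-THEOREM of the K-line, UNCONDITIONAL; PORT GO L2357) — part 1 (RootDecomp1KXAll01): helpers, §XIV.1 nearest root with multiplicity, §XIV.2 Ridout with exponent a/b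

(lens-1 g46 HOME kernel K₅ = HOME/decomp-schanuel-lens-1/g46/XAll.lean 4f432885…, 1310 l, ONE import …RootDecomp1KXTop03; P₅/C₅ + NODE-g46.md. Port by census-1 gen 20 as `RootDecomp1KXAll01–06` (the memo's 01–05 split with §XIV.8 cut in two by the 400-line cap): 01 = private helper copies + §XIV.1 roots with multiplicity in `ℂ₂` and the nearest-root lemma without separability (`roots_data_mult`, `nearest_root_mult`, `rootMultiplicity_le_one_of_separable`, `rootMultiplicity_le_natDegree'`) + §XIV.2 Ridout for rationals with exponent `κ = a/b > 2` (`ridout_one_pow`, `ridout_window_pow`; tree `Ridout.finite_of_abs_le_one` BY NAME, called once); 02 = §XIV.3 the dichotomy with multiplicity (`near_root_or_at_infinity_mult`) + §XIV.4 its arithmetic end (`dichotomy_arith_mult`); 03 = §XIV.5 THE PARAMETRIC THEOREM `thinFibreAt_xPoly_mult` (+ `_claim`, `_again` private, `_crude`) + §XIV.6 every `P ∈ ℤ[x][Y]` (`xCoeff`, `topX`, `eTop`, `muTop`, `thinThreshold`, `xPolyP_xCoeff`, **`thinFibreAt_all`**, `thinFibreAt_effective`); 04 = §XIV.7 CONSUMER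 for all x-degrees (`xCoeff_dX`, …, `thinThreshold_dX_le`, `no_relation_of_closed_class`, `allCurves_nonvanishing`); 05 = §XIV.8 thresholds of `xPolyP k c` in the data `(μ, e)`, specialisations BY NAME (examples against tree `…XTop.thinFibreAt_xPoly`, `…XLinearII.thinFibreAt_xLinear_sep`, `ridout_window`, `dichotomy_arith`), root-multiplicity bounds, the P₃-family `thinFibreAt_purePowerTop`; 06 = members P₁ P₂ P₃ with thresholds 5 / 7 / 5 proved as theorems + CONSUMER at the members.
PORT EDITS (sanctioned in VERDICT L2357 (a)–(e)): `set_option linter.dupNamespace false` dropped; `thinFibreAt_xPoly_again` and `thinFibreAt_xLinear_sep_again` (type-twins of tree `…XTop.thinFibreAt_xPoly` / `…XLinearII.thinFibreAt_xLinear_sep`) made `private` (dedup); per-part private helper copies; the two scoped `set_option maxHeartbeats 400000 in` kept as in K₅; `example` blocks kept; 19 one-line docstrings added (gate lint.docstring); statements and proofs otherwise verbatim. `--supports stmt-Schanuel-33364`; no census credit carried; rung 0 — nothing here proves Schanuel; no ∀-item of 1K moves.)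
-/

/-!
# RootDecomp1KXAll — lens 1, generation 46, node 5 (g46) «ALL CURVES: thin fibres for EVERY `P ∈ ℤ[x][Y]`,
at every quality `m₀ ≥ m(P) = max(3, 2μ(P)+1, e(P)+1)`» (critic RULE K-R35: the multiple finite points over
`x = ∞` — top `x`-coefficient NON-separable — closed; THEOREM lane, HOME kernel K₅; ONE tree import
`…Theorems.RootDecomp1KXTop03` (nodes 1–4 of the lineage BY NAME: `ThinFibreAt`, `xPolyP`, `top_coeff_small`,
`levels_finite_of_nondeg`, `at_infinity_of_const_top`, `infinity_arith`, `engine_of_clause`, …), Ridout's theorem by the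
tree name `Literature.NumberTheory.DiophantineApproximation.Ridout.finite_of_abs_le_one`, no hypothesis binder, no
`sorry`, no `native_decide`, two scoped `set_option maxHeartbeats 400000 in`, no ledger writes).

For `P = Σ_{j ≤ k} x^j · c_j(Y)` (`k = xdeg P`, `c_k ≠ 0` the TOP `x`-coefficient) put
* `μ(P)` := the largest multiplicity of a root of `c_k` in `ℂ₂ = PadicAlgCl 2` (`μ ≤ 1` iff `c_k` separable),
* `e(P)` := `deg_Y P − deg c_k` = the order of the point `(∞, ∞)`.
THEOREM (`thinFibreAt_all`): `ThinFibreAt m₀ P` for every `P ≠ 0` and every `m₀ ≥ thinThreshold P :=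
max 3 (max (2·μ(P)+1) (e(P)+1))`.  (With the free regime `thinFibreAt_of_natDegree_lt` of node 1 the effective
threshold is `min (deg_Y P + 1) (thinThreshold P)`.)

MECHANISM = node 4's (g45d) architecture — 2^{N!}-weighted level identity, ultrametric domination of the top power
(`top_coeff_small`), near-root / at-infinity dichotomy, the `(∞,∞)` chart by `infinity_arith` WITHOUT Diophantine
input — with ONE new estimate and ONE generalised Diophantine step:
(i)  NEAREST ROOT WITH MULTIPLICITY (`nearest_root_mult`, ultrametric, global): `c_k = lc·∏_{β∈T}(X−β)^{n_β}` over
     `ℂ₂` gives `∀ z ∃ β ∈ T, (min 1 ‖z−β‖)^μ ≤ c·‖c_k(z)‖` as soon as all `n_β ≤ μ`;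
(ii) RIDOUT WITH EXPONENT `κ = a/b > 2` (`ridout_window_pow`, from tree `Ridout.finite_of_abs_le_one` BY NAME),
     used at `(a, b) = (4μ+1, 2μ)`, `κ = 2 + 1/(2μ)`; and the arithmetic end `dichotomy_arith_mult`:
     `‖r−β‖^μ ≤ c·2^{−N!}` and NOT `den^{4μ+1}·‖r−β‖^{2μ} ≤ 1` force `den^{(2μ+1)N} > C·2^{(N+1)!}`.
WHY `2μ+1`: a rational point 2-adically near a `μ`-fold root `β` of `c_k` is only certified to `‖r−β‖^μ ≲ 2^{−N!}`
(Puiseux slope `1/μ` at the ramified place of `Y` over `x = ∞`), and Roth's `2+ε` then needs `m₀ > 2μ`: `2μ+1` is the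
Roth-sharp value of the one-level projective method (`μ = 1 ↦ 3` = g45c/g45d).  NOT derived here (and not
derivable from a threshold theorem): `ThinFibre m₀` (all `P` at ONE `m₀`), the (b)-cell, `m₀ = 2`.
CONSUMER (`allCurves_nonvanishing`): for `ρ ∈ Skel₍m₎` and every `P ≠ 0` with `thinThreshold P ≤ m`,
`P(ℓ₂, ρ) ≠ 0` — for ALL `x`-degrees, the `∂P/∂x`-non-degeneracy coming from node-1's `∂ₓ`-descent run inside the
class `{thinThreshold ≤ m}`, which is descent-closed (`thinThreshold (dX P) ≤ thinThreshold P`).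
-/

noncomputable section

namespace Summit.Schanuel.Schanuel.Theorems.RootDecomp1KXAll

open Polynomial LiouvilleNumber
open scoped Nat
open Summit.Schanuel.Schanuel.Theorems.RootDecomp1KSkelCell
  (exists_le_two_pow_factorial iota iota_spec iota_le_of_le pow_lt_of_lt_iota lt_iota_of_pow_lt iota_mono
   one_le_iota SkelLiouville SkelLiouvilleFix skelLiouville_iff_fix SkelLiouvilleFix.mono uStar dU rU dU_cast
   two_pow_le_four_mul_dU two_mul_dU_lt one_le_dU rU_den rU_cast uStar_sub_rU skelLiouvilleFix_one_uStar
   not_skelFixOne_algebraicIndependent)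
open Summit.Schanuel.Schanuel.Theorems.RootDecomp1KTwoBaseCell (psNumer partialSum_eq_psNumer_div coprime_psNumer
  algebraicIndependent_of_forall_int')
open Summit.Schanuel.Schanuel.Theorems.RootDecomp1KRelLiouvilleCell (partialSum_two_strictMono
  partialSum_two_lt_liouvilleNumber abs_liouvilleNumber_two_sub_partialSum)
open Summit.Schanuel.Schanuel.Theorems.RootDecomp1KDegreeLadder
open Summit.Schanuel.Schanuel.Theorems.RootDecomp1KXLinearCore
open Summit.Schanuel.Schanuel.Theorems.RootDecomp1KXLinear
open Summit.Schanuel.Schanuel.Theorems.RootDecomp1KXLinearII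
open Summit.Schanuel.Schanuel.Theorems.RootDecomp1KXTop

/-! ### small private helpers (copies of private tree helpers) -/

/-- `s_N = p_N / 2^{N!}`. -/
private theorem partialSum_two (N : ℕ) : partialSum 2 N = (psNumer 2 N : ℝ) / (2 : ℝ) ^ N ! := by
  have := partialSum_eq_psNumer_div (b := 2) (by norm_num) N
  simpa using this

/-- `‖2‖₂ = 1/2` in `PadicAlgCl 2`. -/
private theorem norm_two : ‖(2 : PadicAlgCl 2)‖ = 1 / 2 := by
  have h1 : ((2 : ℕ) : PadicAlgCl 2) = algebraMap ℚ_[2] (PadicAlgCl 2) ((2 : ℕ) : ℚ_[2]) :=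
    (map_natCast _ 2).symm
  have h2 : ‖((2 : ℕ) : ℚ_[2])‖ = (↑(2 : ℕ) : ℝ)⁻¹ := Padic.norm_p
  have h3 : ‖((2 : ℕ) : PadicAlgCl 2)‖ = 1 / 2 := by rw [h1, PadicAlgCl.norm_extends, h2]; norm_num
  simpa using h3

/-- `‖2^t‖₂ = 2^{−t}`. -/
private theorem norm_two_pow (t : ℕ) : ‖(2 : PadicAlgCl 2) ^ t‖ = (1 / 2 : ℝ) ^ t := by
  rw [norm_pow, norm_two]

/-- `‖(z : \overline{ℚ₂})‖ ≤ 1` for integers. -/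
private theorem norm_intCast_le_one' (z : ℤ) : ‖(z : PadicAlgCl 2)‖ ≤ 1 := by
  have h1 : (z : PadicAlgCl 2) = algebraMap ℚ_[2] (PadicAlgCl 2) (z : ℚ_[2]) := (map_intCast _ z).symm
  rw [h1, PadicAlgCl.norm_extends]
  exact Padic.norm_int_le_one z

/-- `ℓ₂ = liouvilleNumber 2` is Liouville (Mathlib). -/
private theorem liouville_ell2' : Liouville (liouvilleNumber 2) := by
  have h := liouville_liouvilleNumber (le_refl 2)
  simpa using h

/-! ## §XIV.1  Roots WITH MULTIPLICITY in `ℂ₂` and the nearest-root lemma without separability -/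

/-- Roots of an arbitrary non-zero `B ∈ ℤ[Y]` in `ℂ₂ = PadicAlgCl 2`: the finset `T` of distinct roots, the
multiplicities `n β = rootMultiplicity β B` (`≥ 1` on `T`, summing to `deg B`) and the product formula
`B(z) = lc · ∏_{β ∈ T} (z − β)^{n β}`. -/
theorem roots_data_mult (B : ℤ[X]) (hB : B ≠ 0) :
    ∃ (T : Finset (PadicAlgCl 2)) (n : PadicAlgCl 2 → ℕ),
      (∀ β ∈ T, aeval β B = 0) ∧ (∀ β ∈ T, 1 ≤ n β) ∧
      (∀ β, n β = rootMultiplicity β (B.map (algebraMap ℤ (PadicAlgCl 2)))) ∧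
      (∑ β ∈ T, n β = B.natDegree) ∧
      ∀ z : PadicAlgCl 2, aeval z B = (B.leadingCoeff : PadicAlgCl 2) * ∏ β ∈ T, (z - β) ^ n β := by
  classical
  set p : (PadicAlgCl 2)[X] := B.map (algebraMap ℤ (PadicAlgCl 2)) with hp
  have hinj : Function.Injective (algebraMap ℤ (PadicAlgCl 2)) := (algebraMap ℤ (PadicAlgCl 2)).injective_int
  have hp0 : p ≠ 0 := (Polynomial.map_ne_zero_iff hinj).mpr hB
  have hlc : p.leadingCoeff = (B.leadingCoeff : PadicAlgCl 2) := by
    rw [hp, leadingCoeff_map_of_injective hinj]; exact eq_intCast _ _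
  have hdeg : p.natDegree = B.natDegree := by rw [hp, natDegree_map_eq_of_injective hinj]
  have hcardr : p.roots.card = p.natDegree := IsAlgClosed.card_roots_eq_natDegree
  have hprod : C p.leadingCoeff * (p.roots.map fun a => X - C a).prod = p :=
    C_leadingCoeff_mul_prod_multiset_X_sub_C hcardr
  have hevp : ∀ z : PadicAlgCl 2, eval z p = aeval z B := fun z => by
    rw [hp, eval_map, ← aeval_def]
  refine ⟨p.roots.toFinset, fun β => p.roots.count β, ?_, ?_, ?_, ?_, ?_⟩
  · intro β hβ
    have h1 : eval β p = 0 := (mem_roots hp0).mp (Multiset.mem_toFinset.mp hβ)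
    rwa [hevp] at h1
  · intro β hβ
    exact Multiset.one_le_count_iff_mem.mpr (Multiset.mem_toFinset.mp hβ)
  · intro β
    exact count_roots p
  · rw [Multiset.toFinset_sum_count_eq, hcardr, hdeg]
  · intro z
    rw [← hevp z]
    conv_lhs => rw [← hprod]
    rw [eval_mul, eval_C, hlc, Finset.prod_multiset_map_count, eval_prod]
    congr 1
    refine Finset.prod_congr rfl fun β _ => ?_
    rw [eval_pow, eval_sub, eval_X, eval_C]

/-- **Nearest-root lemma WITH MULTIPLICITY** (no separability): if every root of `B` in `ℂ₂` has multiplicity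
`≤ μ`, then every `z ∈ ℂ₂` has a root `β` of `B` with `(min 1 ‖z − β‖₂)^μ ≤ c · ‖B(z)‖₂`.  (Ultrametric: for the
nearest root `β₀` and any other root `β`, `‖z − β‖ ≥ ‖β₀ − β‖`, so `‖lc‖·D(β₀)·‖z − β₀‖^{n β₀} ≤ ‖B(z)‖`.) -/
theorem nearest_root_mult (B : ℤ[X]) (hb : 1 ≤ B.natDegree) (μ : ℕ)
    (hmult : ∀ β : PadicAlgCl 2, rootMultiplicity β (B.map (algebraMap ℤ (PadicAlgCl 2))) ≤ μ) :
    ∃ (T : Finset (PadicAlgCl 2)) (n : PadicAlgCl 2 → ℕ) (c : ℝ), 0 < c ∧ (∀ β ∈ T, aeval β B = 0) ∧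
      (∑ β ∈ T, n β = B.natDegree) ∧
      (∀ z : PadicAlgCl 2, aeval z B = (B.leadingCoeff : PadicAlgCl 2) * ∏ β ∈ T, (z - β) ^ n β) ∧
      ∀ z : PadicAlgCl 2, ∃ β ∈ T, min 1 ‖z - β‖ ^ μ ≤ c * ‖aeval z B‖ := by
  classical
  have hB : B ≠ 0 := by rintro rfl; simp at hb
  obtain ⟨T, n, hroots, hn1, hnmult, hsum, hprod⟩ := roots_data_mult B hB
  have hne : T.Nonempty := by
    rw [Finset.nonempty_iff_ne_empty]
    rintro rfl
    rw [Finset.sum_empty] at hsum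
    omega
  have hℓ : (0 : ℝ) < ‖(B.leadingCoeff : PadicAlgCl 2)‖ := by
    rw [norm_pos_iff]; exact_mod_cast leadingCoeff_ne_zero.mpr hB
  set D : PadicAlgCl 2 → ℝ := fun β₀ => ∏ β ∈ T.erase β₀, ‖β₀ - β‖ ^ n β with hD
  have hDpos : ∀ β₀ ∈ T, 0 < D β₀ := by
    intro β₀ hβ₀
    apply Finset.prod_pos
    intro β hβ
    apply pow_pos
    rw [norm_pos_iff, sub_ne_zero]
    exact (Finset.ne_of_mem_erase hβ).symm
  set c : ℝ := ∑ β₀ ∈ T, 1 / (‖(B.leadingCoeff : PadicAlgCl 2)‖ * D β₀) with hc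
  have hcpos : 0 < c :=
    Finset.sum_pos (fun β₀ hβ₀ => one_div_pos.mpr (mul_pos hℓ (hDpos β₀ hβ₀))) hne
  refine ⟨T, n, c, hcpos, hroots, hsum, hprod, fun z => ?_⟩
  obtain ⟨β₀, hβ₀T, hmin⟩ := T.exists_min_image (fun β => ‖z - β‖) hne
  refine ⟨β₀, hβ₀T, ?_⟩
  -- lower bound for the other factors
  have hfac : ∀ β ∈ T.erase β₀, ‖β₀ - β‖ ^ n β ≤ ‖z - β‖ ^ n β := by
    intro β hβ
    have hβT : β ∈ T := Finset.mem_of_mem_erase hβ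
    have h1 := IsUltrametricDist.norm_add_le_max (z - β) (-(z - β₀))
    rw [norm_neg, ← sub_eq_add_neg, show z - β - (z - β₀) = β₀ - β by ring] at h1
    exact pow_le_pow_left₀ (norm_nonneg _) (h1.trans (max_le le_rfl (hmin β hβT))) _
  have hlow : ‖(B.leadingCoeff : PadicAlgCl 2)‖ * (‖z - β₀‖ ^ n β₀ * D β₀) ≤ ‖aeval z B‖ := by
    rw [hprod z, norm_mul, norm_prod]
    simp only [norm_pow]
    rw [← Finset.mul_prod_erase T (fun β => ‖z - β‖ ^ n β) hβ₀T]
    refine mul_le_mul_of_nonneg_left (mul_le_mul_of_nonneg_left ?_ (by positivity)) hℓ.le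
    exact Finset.prod_le_prod (fun β _ => by positivity) hfac
  have hkey : ‖z - β₀‖ ^ n β₀ ≤ 1 / (‖(B.leadingCoeff : PadicAlgCl 2)‖ * D β₀) * ‖aeval z B‖ := by
    have hpos : 0 < ‖(B.leadingCoeff : PadicAlgCl 2)‖ * D β₀ := mul_pos hℓ (hDpos β₀ hβ₀T)
    rw [one_div, ← div_eq_inv_mul, le_div_iff₀ hpos]
    calc ‖z - β₀‖ ^ n β₀ * (‖(B.leadingCoeff : PadicAlgCl 2)‖ * D β₀)
        = ‖(B.leadingCoeff : PadicAlgCl 2)‖ * (‖z - β₀‖ ^ n β₀ * D β₀) := by ring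
      _ ≤ ‖aeval z B‖ := hlow
  have hmin1 : min 1 ‖z - β₀‖ ^ μ ≤ ‖z - β₀‖ ^ n β₀ := by
    have hnμ : n β₀ ≤ μ := by rw [hnmult]; exact hmult β₀
    have h0 : 0 ≤ min 1 ‖z - β₀‖ := le_min zero_le_one (norm_nonneg _)
    calc min 1 ‖z - β₀‖ ^ μ ≤ min 1 ‖z - β₀‖ ^ n β₀ := pow_le_pow_of_le_one h0 (min_le_left _ _) hnμ
      _ ≤ ‖z - β₀‖ ^ n β₀ := pow_le_pow_left₀ h0 (min_le_right _ _) _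
  refine hmin1.trans (hkey.trans (mul_le_mul_of_nonneg_right ?_ (norm_nonneg _)))
  exact Finset.single_le_sum (f := fun β₀ => 1 / (‖(B.leadingCoeff : PadicAlgCl 2)‖ * D β₀))
    (fun β₀ hβ₀ => (one_div_pos.mpr (mul_pos hℓ (hDpos β₀ hβ₀))).le) hβ₀T

/-- separable ⇒ all multiplicities `≤ 1` (so `μ = 1` is node 4's hypothesis). -/
theorem rootMultiplicity_le_one_of_separable (B : ℤ[X]) (hsep : (B.map (Int.castRingHom ℚ)).Separable)
    (β : PadicAlgCl 2) : rootMultiplicity β (B.map (algebraMap ℤ (PadicAlgCl 2))) ≤ 1 := by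
  classical
  set p : (PadicAlgCl 2)[X] := B.map (algebraMap ℤ (PadicAlgCl 2)) with hp
  have hsep' : p.Separable := by
    have e : p = (B.map (Int.castRingHom ℚ)).map (algebraMap ℚ (PadicAlgCl 2)) := by
      rw [hp, Polynomial.map_map]
      congr 1
    rw [e]; exact hsep.map
  rw [← count_roots p]
  exact count_roots_le_one hsep' β

/-- the crude bound: every multiplicity is `≤ deg B`. -/
theorem rootMultiplicity_le_natDegree' (B : ℤ[X]) (β : PadicAlgCl 2) :
    rootMultiplicity β (B.map (algebraMap ℤ (PadicAlgCl 2))) ≤ B.natDegree := by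
  classical
  set p : (PadicAlgCl 2)[X] := B.map (algebraMap ℤ (PadicAlgCl 2)) with hp
  rw [← count_roots p]
  calc p.roots.count β ≤ p.roots.card := Multiset.count_le_card _ _
    _ ≤ p.natDegree := card_roots' p
    _ ≤ B.natDegree := natDegree_map_le

/-! ## §XIV.2  Ridout for rationals with a general exponent `κ = a/b > 2` (tree `Ridout.finite_of_abs_le_one` BY NAME) -/

/-- the root step: `d^a · x^b ≤ 1`, `x ≥ 0`, `d > 0`, `b > 0` ⇒ `x ≤ d^{−a/b}`. -/
private theorem le_rpow_of_pow (x d : ℝ) (a b : ℕ) (hb : 0 < b) (hx : 0 ≤ x) (hd : 0 < d)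
    (h : d ^ a * x ^ b ≤ 1) : x ≤ d ^ (-((a : ℝ) / b)) := by
  set y : ℝ := d ^ (-((a : ℝ) / b)) with hy
  have hypos : 0 < y := Real.rpow_pos_of_pos hd _
  have hbR : (b : ℝ) ≠ 0 := by exact_mod_cast hb.ne'
  have hyb : y ^ b = (d ^ a)⁻¹ := by
    rw [hy, ← Real.rpow_natCast (d ^ (-((a : ℝ) / b))) b, ← Real.rpow_mul hd.le,
      show (-((a : ℝ) / b)) * (b : ℝ) = -((a : ℕ) : ℝ) by field_simp, Real.rpow_neg hd.le, Real.rpow_natCast]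
  have hxb : x ^ b ≤ y ^ b := by
    rw [hyb, inv_eq_one_div, le_div_iff₀ (by positivity)]
    linarith [h]
  exact (pow_le_pow_iff_left₀ hx hypos.le hb.ne').mp hxb

/-- One target `θ ∈ ℂ₂`, root of a monic `Q ∈ ℤ[X]`, exponent `a/b > 2`: the rationals `ρ`, `|ρ| ≤ 1`, with
`den(ρ)^a · ‖ρ − θ‖₂^b ≤ 1` form a finite set (Ridout at the place `2`, tree `Ridout.finite_of_abs_le_one`). -/
theorem ridout_one_pow (Q : ℤ[X]) (hQm : Q.Monic) (hQd : 1 ≤ Q.natDegree)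
    (θ : PadicAlgCl 2) (hθ : aeval θ Q = 0) (a b : ℕ) (hb : 0 < b) (hab : 2 * b < a) :
    {ρ : ℚ | |(ρ : ℝ)| ≤ 1 ∧ (ρ.den : ℝ) ^ a * ‖(ρ : PadicAlgCl 2) - θ‖ ^ b ≤ 1}.Finite := by
  classical
  let α : ∀ p : Nat.Primes, @PadicAlgCl (p : ℕ) ⟨p.2⟩ := fun p =>
    if hp : p = pTwo then (by subst hp; exact θ) else 0
  have hα : α pTwo = θ := by
    show (if hp : pTwo = pTwo then _ else _) = _
    rw [dif_pos rfl]
  have hroot : ∀ p ∈ ({pTwo} : Finset Nat.Primes), Polynomial.aeval (α p) ((fun _ => Q) p) = 0 := by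
    intro p hp
    rw [Finset.mem_singleton] at hp
    subst hp
    rw [hα]
    exact hθ
  have hκ : (2 : ℝ) < (a : ℝ) / b := by
    rw [lt_div_iff₀ (by exact_mod_cast hb)]
    exact_mod_cast hab
  have hF := Literature.NumberTheory.DiophantineApproximation.Ridout.finite_of_abs_le_one {pTwo} (fun _ => Q)
    (fun _ _ => hQm) (fun _ _ => hQd) α hroot hκ
  refine hF.subset fun ρ hρ => ?_
  obtain ⟨h1, h2⟩ := hρ
  refine ⟨h1, ?_⟩
  show |(ρ : ℝ)| * (∏ p ∈ ({pTwo} : Finset Nat.Primes), min (1 : ℝ) ‖((ρ : ℚ) : @PadicAlgCl (p : ℕ) ⟨p.2⟩) - α p‖)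
    ≤ (ρ.den : ℝ) ^ (-((a : ℝ) / b))
  rw [Finset.prod_singleton]
  have e1 : min (1 : ℝ) ‖((ρ : ℚ) : PadicAlgCl 2) - α pTwo‖ = min (1 : ℝ) ‖(ρ : PadicAlgCl 2) - θ‖ := by rw [hα]
  rw [e1]
  have hx0 : 0 ≤ ‖(ρ : PadicAlgCl 2) - θ‖ := norm_nonneg _
  have hd : (0 : ℝ) < ρ.den := by exact_mod_cast ρ.den_pos
  calc |(ρ : ℝ)| * min (1 : ℝ) ‖(ρ : PadicAlgCl 2) - θ‖ ≤ 1 * ‖(ρ : PadicAlgCl 2) - θ‖ :=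
        mul_le_mul h1 (min_le_right _ _) (le_min zero_le_one hx0) zero_le_one
    _ = ‖(ρ : PadicAlgCl 2) - θ‖ := one_mul _
    _ ≤ (ρ.den : ℝ) ^ (-((a : ℝ) / b)) := le_rpow_of_pow _ _ a b hb hx0 hd h2

/-- **Ridout with exponent `a/b`, packaged for the curve**: for `B ∈ ℤ[Y]` of degree `≥ 1`, a window `|r| ≤ C` and
natural numbers `2b < a`, the rationals `r` with a root `β ∈ ℂ₂` of `B` such that
`den(r)^a · ‖lc_B·(r − β)‖₂^b ≤ 1` form a finite set.  (`(a, b) = (5, 2)` is the tree's `ridout_window`.) -/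
theorem ridout_window_pow (B : ℤ[X]) (hb : 1 ≤ B.natDegree) (C : ℝ) (a b : ℕ) (hb0 : 0 < b)
    (hab : 2 * b < a) :
    {r : ℚ | |(r : ℝ)| ≤ C ∧ ∃ β : PadicAlgCl 2, aeval β B = 0 ∧
      (r.den : ℝ) ^ a * ‖(B.leadingCoeff : PadicAlgCl 2) * ((r : PadicAlgCl 2) - β)‖ ^ b ≤ 1}.Finite := by
  classical
  have hB : B ≠ 0 := by rintro rfl; simp at hb
  set ℓ : ℤ := B.leadingCoeff with hℓ
  have hℓ0 : ℓ ≠ 0 := leadingCoeff_ne_zero.mpr hB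
  set Q : ℤ[X] := integralNormalization B with hQ
  have hQm : Q.Monic := monic_integralNormalization hB
  have hQd : 1 ≤ Q.natDegree := by rw [hQ, natDegree_integralNormalization]; exact hb
  have hQroot : ∀ β : PadicAlgCl 2, aeval β B = 0 → aeval ((ℓ : PadicAlgCl 2) * β) Q = 0 := by
    intro β hβ
    have h := integralNormalization_aeval_eq_zero (A := PadicAlgCl 2) hβ
      (fun x hx => by simpa using hx)
    simpa [hℓ] using h
  have hQn : ∀ n : ℤ, (Q.comp (X + Polynomial.C n)).Monic ∧ 1 ≤ (Q.comp (X + Polynomial.C n)).natDegree ∧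
      ∀ β : PadicAlgCl 2, aeval β B = 0 → aeval ((ℓ : PadicAlgCl 2) * β - n) (Q.comp (X + Polynomial.C n)) = 0 := by
    intro n
    refine ⟨hQm.comp (monic_X_add_C n) (by rw [natDegree_X_add_C]; exact one_ne_zero), ?_, ?_⟩
    · rw [natDegree_comp, natDegree_X_add_C, mul_one]; exact hQd
    · intro β hβ
      rw [aeval_comp]
      simpa using hQroot β hβ
  have hroots : {β : PadicAlgCl 2 | aeval β B = 0}.Finite := by
    have h := B.rootSet_finite (PadicAlgCl 2)
    refine h.subset fun β hβ => ?_
    rw [mem_rootSet]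
    exact ⟨hB, hβ⟩
  obtain ⟨K, hK⟩ : ∃ K : ℕ, |(ℓ : ℝ)| * |C| + 1 ≤ K := exists_nat_ge _
  have hshifts : (Set.Icc (-(K : ℤ)) K).Finite := Set.finite_Icc _ _
  apply Set.Finite.subset (Set.Finite.biUnion hshifts fun n _ => Set.Finite.biUnion hroots fun β _ =>
    Set.Finite.preimage (f := fun r : ℚ => (ℓ : ℚ) * r - n) ?_ (ridout_one_pow _ (hQn n).1 (hQn n).2.1
      ((ℓ : PadicAlgCl 2) * β - n) ((hQn n).2.2 β ‹β ∈ {β | aeval β B = 0}›) a b hb0 hab))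
  · intro r hr
    obtain ⟨hrC, β, hβ, hineq⟩ := hr
    simp only [Set.mem_iUnion, Set.mem_preimage, Set.mem_setOf_eq, exists_prop]
    set n : ℤ := ⌊(ℓ : ℚ) * r⌋ with hn
    have hn1 : (n : ℚ) ≤ (ℓ : ℚ) * r := Int.floor_le _
    have hn2 : (ℓ : ℚ) * r < n + 1 := Int.lt_floor_add_one _
    refine ⟨n, ?_, β, hβ, ?_, ?_⟩
    · have hlr : |((ℓ : ℚ) * r : ℚ)| ≤ |(ℓ : ℝ)| * |C| := by
        push_cast
        rw [abs_mul]
        exact mul_le_mul_of_nonneg_left (hrC.trans (le_abs_self C)) (abs_nonneg _)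
      have hn1R : (n : ℝ) ≤ (ℓ : ℝ) * r := by exact_mod_cast hn1
      have hn2R : (ℓ : ℝ) * r < n + 1 := by exact_mod_cast hn2
      have hlr' : |(ℓ : ℝ) * r| ≤ |(ℓ : ℝ)| * |C| := by
        have : (((ℓ : ℚ) * r : ℚ) : ℝ) = (ℓ : ℝ) * r := by push_cast; ring
        rw [← this]; exact_mod_cast hlr
      have h3 := abs_le.mp hlr'
      constructor
      · have : (-(K : ℝ)) ≤ n := by linarith
        exact_mod_cast this
      · have : (n : ℝ) ≤ K := by linarith
        exact_mod_cast this
    · have e : ((((ℓ : ℚ) * r - n : ℚ)) : ℝ) = (ℓ : ℝ) * r - n := by push_cast; ring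
      rw [e, abs_le]
      have hn1R : (n : ℝ) ≤ (ℓ : ℝ) * r := by exact_mod_cast hn1
      have hn2R : (ℓ : ℝ) * r < n + 1 := by exact_mod_cast hn2
      constructor <;> linarith
    · have hden : (((ℓ : ℚ) * r - n : ℚ)).den ≤ r.den := by
        rw [Rat.sub_intCast_den]
        have h2 : ((ℓ : ℚ) * r).den ∣ (ℓ : ℚ).den * r.den := Rat.mul_den_dvd _ _
        rw [Rat.den_intCast, one_mul] at h2
        exact Nat.le_of_dvd r.den_pos h2
      have e2 : ((((ℓ : ℚ) * r - n : ℚ)) : PadicAlgCl 2) - ((ℓ : PadicAlgCl 2) * β - n) =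
          (ℓ : PadicAlgCl 2) * ((r : PadicAlgCl 2) - β) := by push_cast; ring
      rw [e2]
      have hdenR : ((((ℓ : ℚ) * r - n : ℚ)).den : ℝ) ≤ r.den := by exact_mod_cast hden
      calc ((((ℓ : ℚ) * r - n : ℚ)).den : ℝ) ^ a * ‖(ℓ : PadicAlgCl 2) * ((r : PadicAlgCl 2) - β)‖ ^ b
          ≤ (r.den : ℝ) ^ a * ‖(ℓ : PadicAlgCl 2) * ((r : PadicAlgCl 2) - β)‖ ^ b := by gcongr
        _ ≤ 1 := hineq
  · intro r₁ _ r₂ _ h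
    have h' : (ℓ : ℚ) * r₁ - n = (ℓ : ℚ) * r₂ - n := h
    have hℓQ : (ℓ : ℚ) ≠ 0 := by exact_mod_cast hℓ0
    exact mul_left_cancel₀ hℓQ (by linarith)

end Summit.Schanuel.Schanuel.Theorems.RootDecomp1KXAll

end
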